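import Mathlib
import HarnessLib

/-!
# `Assembly` (stmt-AtomisticToContinuum-11591), route `EnskogAdjointDuality` — the `L²` squeeze
# of the duality bookkeeping

The pathwise duality estimate of the route (`pathwise_duality_bound`, helper `Pathwise` of
`DualityReduction`) bounds the tested deviation at time `t` along ONE good orbit by five terms,
`|Y_N(z)| ≤ |A_N(z)| + η_N t (1 + e_N(z)) + c_N + |R_N(z)| + |d_N|`
(initial term, defect × conserved energy, the Euler-side defect `|I₃ + ½I₂|`, the collision
residual, the Enskog defect `Res_N`). This file turns such an eventual, almost-sure five-term bound
into the mean-square convergence `∫ Y_N² dP_N → 0` asked by the smooth-test-function `L²` core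
(`EnskogAdjointDualityAssemblyCore.lean`), given: `∫ A_N² → 0`, a uniform bound on
`∫ (1 + e_N)²`, `η_N, c_N, d_N → 0` and `∫ R_N² → 0`. Only `A_N` and `e_N` need to be measurable
(the collision residual `R_N` is integrated last, as an outer lower integral).

* `sq_le_five_mul_of_abs_le` — the pointwise step;
* `tendsto_lintegral_sq_of_eventually_abs_le_five` — the squeeze.

References: M. Pulvirenti, S. Simonella, arXiv:1504.03215, §2 [PulvirentiSimonella2016];
H. Spohn (1991), Part I §3 [Spohn1991].
-/

noncomputable section

open MeasureTheory Set Filter Topology Function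
open scoped ENNReal BigOperators

namespace Summit.AtomisticToContinuum.HydrodynamicLimit.Theorems

/-- Pointwise step: `|y| ≤ |a| + b + c + |r| + |d|` gives
`y² ≤ 5 (a² + b² + c² + r² + d²)`. [folklore] -/
theorem sq_le_five_mul_of_abs_le {y a b c r d : ℝ} (h : |y| ≤ |a| + b + c + |r| + |d|) :
    y ^ 2 ≤ 5 * (a ^ 2 + b ^ 2 + c ^ 2 + r ^ 2 + d ^ 2) := by
  have h0 : 0 ≤ |a| + b + c + |r| + |d| := (abs_nonneg y).trans h
  have h1 : y ^ 2 ≤ (|a| + b + c + |r| + |d|) ^ 2 := by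
    rw [← sq_abs y]
    exact pow_le_pow_left₀ (abs_nonneg y) h 2
  have h2 : (|a| + b + c + |r| + |d|) ^ 2 ≤ 5 * (|a| ^ 2 + b ^ 2 + c ^ 2 + |r| ^ 2 + |d| ^ 2) := by
    nlinarith [sq_nonneg (|a| - b), sq_nonneg (|a| - c), sq_nonneg (|a| - |r|), sq_nonneg (|a| - |d|),
      sq_nonneg (b - c), sq_nonneg (b - |r|), sq_nonneg (b - |d|), sq_nonneg (c - |r|),
      sq_nonneg (c - |d|), sq_nonneg (|r| - |d|)]
  rw [sq_abs, sq_abs, sq_abs] at h2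
  exact h1.trans h2

/-- **The `L²` squeeze.** On probability spaces `(Ω_N, P_N)`: if eventually in `N`, `P_N`-almost
surely `|Y_N| ≤ |A_N| + η_N t (1 + e_N) + c_N + |R_N| + |d_N|` with `A_N, e_N` measurable,
`∫ A_N² dP_N → 0`, `∫ (1 + e_N)² dP_N ≤ C`, `η_N → 0`, `c_N → 0`, `d_N → 0` and `∫ R_N² dP_N → 0`
(outer lower integral, `R_N` need not be measurable), then `∫ Y_N² dP_N → 0`. [folklore] -/
theorem tendsto_lintegral_sq_of_eventually_abs_le_five {Ω : ℕ → Type*}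
    [∀ N, MeasurableSpace (Ω N)] (P : (N : ℕ) → Measure (Ω N)) [∀ N, IsProbabilityMeasure (P N)]
    (Y A e R : (N : ℕ) → Ω N → ℝ) (η c d : ℕ → ℝ) (t : ℝ)
    (hA : ∀ N, Measurable (A N)) (he : ∀ N, Measurable (e N))
    (hbound : ∀ᶠ N in atTop, ∀ᵐ z ∂P N,
      |Y N z| ≤ |A N z| + η N * t * (1 + e N z) + c N + |R N z| + |d N|)
    (hAlim : Tendsto (fun N => ∫⁻ z, ENNReal.ofReal (A N z ^ 2) ∂P N) atTop (𝓝 0))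
    {C : ℝ} (hemom : ∀ N, ∫⁻ z, ENNReal.ofReal ((1 + e N z) ^ 2) ∂P N ≤ ENNReal.ofReal C)
    (hη : Tendsto η atTop (𝓝 0)) (hc : Tendsto c atTop (𝓝 0)) (hd : Tendsto d atTop (𝓝 0))
    (hR : Tendsto (fun N => ∫⁻ z, ENNReal.ofReal (R N z ^ 2) ∂P N) atTop (𝓝 0)) :
    Tendsto (fun N => ∫⁻ z, ENNReal.ofReal (Y N z ^ 2) ∂P N) atTop (𝓝 0) := by
  have hC0 : 0 ≤ max C 0 := le_max_right _ _
  -- the dominating sequence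
  set B : ℕ → ℝ≥0∞ := fun N => ENNReal.ofReal 5 *
    ((∫⁻ z, ENNReal.ofReal (A N z ^ 2) ∂P N) +
      (ENNReal.ofReal ((η N * t) ^ 2 * max C 0) +
      (ENNReal.ofReal (c N ^ 2) + (ENNReal.ofReal (d N ^ 2) +
        ∫⁻ z, ENNReal.ofReal (R N z ^ 2) ∂P N)))) with hB
  -- it tends to `0`
  have hBlim : Tendsto B atTop (𝓝 0) := by
    have h2 : Tendsto (fun N => ENNReal.ofReal ((η N * t) ^ 2 * max C 0)) atTop (𝓝 0) := by
      have hr : Tendsto (fun N => (η N * t) ^ 2 * max C 0) atTop (𝓝 0) := by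
        have := ((hη.mul_const t).pow 2).mul_const (max C 0)
        simpa using this
      simpa using ENNReal.tendsto_ofReal hr
    have h3 : Tendsto (fun N => ENNReal.ofReal (c N ^ 2)) atTop (𝓝 0) := by
      have hr : Tendsto (fun N => c N ^ 2) atTop (𝓝 0) := by simpa using hc.pow 2
      simpa using ENNReal.tendsto_ofReal hr
    have h4 : Tendsto (fun N => ENNReal.ofReal (d N ^ 2)) atTop (𝓝 0) := by
      have hr : Tendsto (fun N => d N ^ 2) atTop (𝓝 0) := by simpa using hd.pow 2
      simpa using ENNReal.tendsto_ofReal hr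
    have hs := hAlim.add (h2.add (h3.add (h4.add hR)))
    simp only [add_zero] at hs
    have := ENNReal.Tendsto.const_mul hs (Or.inr ENNReal.ofReal_ne_top :
      (0 : ℝ≥0∞) ≠ 0 ∨ ENNReal.ofReal 5 ≠ ⊤)
    simpa [hB] using this
  refine tendsto_of_tendsto_of_tendsto_of_le_of_le' tendsto_const_nhds hBlim
    (Eventually.of_forall fun N => bot_le) ?_
  filter_upwards [hbound] with N hN
  -- pointwise (a.e.) domination
  have hpt : ∀ᵐ z ∂P N, ENNReal.ofReal (Y N z ^ 2) ≤
      ENNReal.ofReal 5 * (ENNReal.ofReal (A N z ^ 2) +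
        (ENNReal.ofReal ((η N * t) ^ 2) * ENNReal.ofReal ((1 + e N z) ^ 2) +
        (ENNReal.ofReal (c N ^ 2) + (ENNReal.ofReal (d N ^ 2) + ENNReal.ofReal (R N z ^ 2))))) := by
    filter_upwards [hN] with z hz
    have hsq := sq_le_five_mul_of_abs_le hz
    rw [← ENNReal.ofReal_mul (sq_nonneg _), ← mul_pow,
      ← ENNReal.ofReal_add (sq_nonneg _) (sq_nonneg _),
      ← ENNReal.ofReal_add (sq_nonneg _) (by positivity),
      ← ENNReal.ofReal_add (sq_nonneg _) (by positivity),
      ← ENNReal.ofReal_add (sq_nonneg _) (by positivity), ← ENNReal.ofReal_mul (by norm_num)]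
    refine ENNReal.ofReal_le_ofReal ?_
    linarith
  -- measurability of the peeled summands
  have hAm : Measurable fun z => ENNReal.ofReal (A N z ^ 2) := ((hA N).pow_const 2).ennreal_ofReal
  have hem : Measurable fun z => ENNReal.ofReal ((η N * t) ^ 2) * ENNReal.ofReal ((1 + e N z) ^ 2) :=
    measurable_const.mul ((measurable_const.add (he N)).pow_const 2).ennreal_ofReal
  calc ∫⁻ z, ENNReal.ofReal (Y N z ^ 2) ∂P N
      ≤ ∫⁻ z, ENNReal.ofReal 5 * (ENNReal.ofReal (A N z ^ 2) +
          (ENNReal.ofReal ((η N * t) ^ 2) * ENNReal.ofReal ((1 + e N z) ^ 2) +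
          (ENNReal.ofReal (c N ^ 2) + (ENNReal.ofReal (d N ^ 2) + ENNReal.ofReal (R N z ^ 2))))) ∂P N :=
        lintegral_mono_ae hpt
    _ = ENNReal.ofReal 5 * ((∫⁻ z, ENNReal.ofReal (A N z ^ 2) ∂P N) +
          (ENNReal.ofReal ((η N * t) ^ 2) * (∫⁻ z, ENNReal.ofReal ((1 + e N z) ^ 2) ∂P N) +
          (ENNReal.ofReal (c N ^ 2) + (ENNReal.ofReal (d N ^ 2) +
            ∫⁻ z, ENNReal.ofReal (R N z ^ 2) ∂P N)))) := by
        rw [lintegral_const_mul' _ _ ENNReal.ofReal_ne_top, lintegral_add_left hAm,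
          lintegral_add_left hem, lintegral_const_mul' _ _ ENNReal.ofReal_ne_top,
          lintegral_add_left measurable_const, lintegral_const, measure_univ,
          mul_one, lintegral_add_left measurable_const, lintegral_const, measure_univ, mul_one]
    _ ≤ B N := by
        simp only [hB]
        gcongr
        rw [ENNReal.ofReal_mul (sq_nonneg _)]
        gcongr
        exact (hemom N).trans (ENNReal.ofReal_le_ofReal (le_max_left _ _))

end Summit.AtomisticToContinuum.HydrodynamicLimit.Theorems

end
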